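import Mathlib.Topology.NoetherianSpace
import Mathlib.RingTheory.KrullDimension.Polynomial
import Mathlib.RingTheory.KrullDimension.Field
import Literature.NumberTheory.Automorphic.IdentityComponent
import HarnessLib

/-!
# The Zariski topology on `GL n k`: irreducibility of connected groups, closures, Borel subgroups

Companion to `LinearAlgebraicGroups.lean` and `IdentityComponent.lean` (namespace
`Literature.Automorphic`), in the same concrete `k`-points vocabulary (an algebraic group is a subgroup
`H ≤ GL n k` cut out by polynomials in the matrix entries and `det⁻¹`, `IsAlgebraicSubgroup`;
"connected" means "no proper algebraic subgroup of finite index", `IsZConnected`). Following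
Springer, *Linear Algebraic Groups* (2nd ed.), 1.1–1.2, 1.8, 2.1–2.2 and 6.2, this file
provides:

* `zariskiTopologyGL n k` — the Zariski topology on `GL n k` (closed sets = zero loci
  `zeroLocusGL S`), a `def` used as a *local* instance only; `isClosed_zariski_iff`,
  `isAlgebraicSubgroup_iff_isClosed`; polynomial self-maps `IsPolyMapGL` (closed under products
  and inverses, `IsPolyMapGL.mul`, `IsPolyMapGL.inv`) are continuous (`IsPolyMapGL.continuous`),
  whence continuity of translations, inversion and commutator maps
  (`continuous_mul_left_zariski`, `continuous_mul_right_zariski`, `continuous_inv_zariski`,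
  `continuous_commutatorElement_left/right_zariski`, the homeomorphisms `zariskiMulLeft`,
  `zariskiMulRight`); points are closed; `noetherianSpace_zariskiGL` (Springer 1.1.2–1.2.1:
  `k[x_{ij}, det⁻¹]` is Noetherian);
* `isPrime_vanishingIdeal_of_isIrreducible` (Springer 1.2.5) and
  **`IsZConnected.isIrreducible`** (Springer 2.2.1 (i), proved: a connected algebraic subgroup is
  irreducible — the stabiliser of a maximal irreducible subset is a closed subgroup of finite
  index; for the converse see `isZConnected_of_isIrreducible` of `ZariskiGLProducts.lean`),
  `IsZConnected.isPrime_vanishingIdeal`;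
* `IsZConnected.primePoint`, `IsZConnected.primeHeight` (the height of the prime vanishing
  ideal in `Spec k[x_{ij}, det⁻¹]`, finite because `dim k[x_{ij}, det⁻¹] = n² + 1`, Mathlib
  `MvPolynomial.ringKrullDim_of_isNoetherianRing`) and **`IsZConnected.primeHeight_lt_of_lt`**
  (Springer 1.8.2 in this guise: strictly larger connected algebraic subgroups have strictly
  smaller height, so ascending chains of connected algebraic subgroups are finite);
* **`exists_isBorelIn_ge`** (proved): every connected solvable algebraic subgroup `H` of
  `G ≤ GL n k` lies in a Borel subgroup of `G` in the sense of `IsBorelIn` (Springer 6.2,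
  definition of Borel subgroups: *such subgroups exist — take one of maximal dimension*), and
  `IsTorusSubgroup.exists_isBorelIn_ge` (Springer 6.4.1, proof);
* `zariskiClosure A` — the Zariski closure of a subgroup, a subgroup (Springer 2.2.4 (i)), the
  smallest algebraic subgroup containing `A` (`zariskiClosure_le`);
  **`isZConnected_zariskiClosure_sup`**, `isZConnected_zariskiClosure_iSup` (Springer 2.2.6 (i)
  in closure form: the smallest algebraic subgroup containing a family of connected algebraic
  subgroups is connected), `IsZConnected.zariskiClosure_range` (2.2.5 (iv) in closure form: the
  closure of the image of a connected algebraic subgroup under an algebraic homomorphism is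
  connected),
  `commutator_zariskiClosure_le` (`(Ā, B̄) ⊆ cl (A, B)`, the argument of 2.2.4/2.2.8) and
  **`isSolvable_zariskiClosure`** (the closure of a solvable subgroup is solvable; Borel,
  *Linear Algebraic Groups*, I.2.4).

These are inputs of the structure theory behind Springer 8.1.1 (i) (`rootSubgroup_unique`): see
`RootSubgroupProofs.lean`, where `exists_isBorelIn_ge` applied to `zariskiClosure (T ⊔ U)`
replaces Springer's appeal to 2.2.7 (i) and to the existence of Borel subgroups.

## Mathlib

Used: `TopologicalSpace.ofClosed`, `TopologicalSpace.NoetherianSpace` (with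
`noetherianSpace_TFAE`, `NoetherianSpace.exists_finite_set_isClosed_irreducible`),
`IsIrreducible`, `isIrreducible_iff_sUnion_isClosed`,
`isPreirreducible_iff_isClosed_union_isClosed`,
`MulAction.stabilizer` / `MulAction.orbitEquivQuotientStabilizer` (pointwise action on `Set`),
`MvPolynomial.vanishingIdeal`, `PrimeSpectrum`, `Order.height`, `Order.height_strictMono`,
`Order.height_le_krullDim`, `ringKrullDim`, `MvPolynomial.ringKrullDim_of_isNoetherianRing`,
`derivedSeries`, `Subgroup.commutator_le`. Mathlib has no Zariski topology on the naive points
`σ → k` / `GL n k` (only on `PrimeSpectrum`, `MaximalSpectrum`, `ProjectiveSpectrum`; searched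
`zariskiTopology`, `ZariskiTopology`, `zeroLocus.*TopologicalSpace`), and
`Subgroup.topologicalClosure` needs `IsTopologicalGroup` (joint continuity of multiplication),
which fails for the Zariski topology; hence the hand-rolled `zariskiClosure`.

## References

* T. A. Springer, *Linear Algebraic Groups*, 2nd ed., Progress in Mathematics 9, Birkhäuser
  (1998), 1.1.2–1.1.3, 1.2.1, 1.2.5, 1.8.1–1.8.2, 2.1.1–2.1.4, 2.2.1, 2.2.4–2.2.8,
  6.2 (6.2.6–6.2.7), 6.4.1.
* A. Borel, *Linear Algebraic Groups*, 2nd ed., GTM 126, Springer (1991), I.2.4.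
-/

open scoped Pointwise

namespace Literature.NumberTheory.Automorphic

variable {k : Type*} [Field k] {n : Type*} [Fintype n] [DecidableEq n]

/-! ### The Zariski topology on `GL n k` -/

section Zariski

/-- The union of two zero loci is the zero locus of the pairwise products (Springer 1.1.2).
[folklore] -/
lemma zeroLocusGL_union_zeroLocusGL (S S' : Set (MvPolynomial (GLCoord n) k)) :
    zeroLocusGL (k := k) (n := n) S ∪ zeroLocusGL S' =
      zeroLocusGL (Set.image2 (· * ·) S S') := by
  ext g
  simp only [zeroLocusGL, Set.mem_union, Set.mem_setOf_eq, Set.forall_mem_image2, map_mul]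
  constructor
  · rintro (h | h) p hp q hq
    · rw [h p hp, zero_mul]
    · rw [h q hq, mul_zero]
  · intro h
    by_contra hcon
    push Not at hcon
    obtain ⟨⟨p, hp, hp0⟩, ⟨q, hq, hq0⟩⟩ := hcon
    exact mul_ne_zero hp0 hq0 (h p hp q hq)

/-- The empty set is a zero locus (of the constant `1`). [folklore] -/
lemma zeroLocusGL_one : zeroLocusGL (k := k) (n := n) {1} = ∅ := by
  ext g
  simp [zeroLocusGL]

/-- The **Zariski topology** on `GL n k = GL_n(k)`: the closed sets are the zero loci
`zeroLocusGL S` of sets of polynomials in the matrix entries and `det⁻¹` (Springer 1.1.2–1.1.3,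
2.1.1; the `k`-points version of `LinearAlgebraicGroups.lean`, faithful to the textbook notion for
`k` algebraically closed). A `def`, used as a local instance only. [folklore] -/
@[implicit_reducible]
def zariskiTopologyGL (n k : Type*) [Field k] [Fintype n] [DecidableEq n] :
    TopologicalSpace (GL n k) :=
  TopologicalSpace.ofClosed {Z | ∃ S : Set (MvPolynomial (GLCoord n) k), Z = zeroLocusGL S}
    ⟨{1}, zeroLocusGL_one.symm⟩
    (by
      intro A hA
      choose S hS using fun (Z : Set (GL n k)) (hZ : Z ∈ A) => hA hZ
      refine ⟨⋃ Z : ↥A, S Z.1 Z.2, ?_⟩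
      rw [zeroLocusGL_iUnion, Set.sInter_eq_iInter]
      exact Set.iInter_congr fun Z => hS Z.1 Z.2)
    (by
      rintro A ⟨S, rfl⟩ B ⟨S', rfl⟩
      exact ⟨_, zeroLocusGL_union_zeroLocusGL S S'⟩)

attribute [local instance] zariskiTopologyGL

/-- The Zariski-closed subsets of `GL n k` are exactly the zero loci. [folklore] -/
theorem isClosed_zariski_iff {Z : Set (GL n k)} :
    IsClosed Z ↔ ∃ S : Set (MvPolynomial (GLCoord n) k), Z = zeroLocusGL S := by
  rw [← isOpen_compl_iff]
  change Zᶜᶜ ∈ {Z : Set (GL n k) |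
    ∃ S : Set (MvPolynomial (GLCoord n) k), Z = zeroLocusGL S} ↔ _
  rw [compl_compl]
  rfl

/-- Zero loci are Zariski-closed. [folklore] -/
theorem isClosed_zeroLocusGL (S : Set (MvPolynomial (GLCoord n) k)) :
    IsClosed (zeroLocusGL (k := k) (n := n) S) :=
  isClosed_zariski_iff.2 ⟨S, rfl⟩

/-- An algebraic subgroup is Zariski-closed. [folklore] -/
theorem IsAlgebraicSubgroup.isClosed {H : Subgroup (GL n k)} (hH : IsAlgebraicSubgroup H) :
    IsClosed (H : Set (GL n k)) :=
  isClosed_zariski_iff.2 hH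

/-- A subgroup is algebraic iff it is Zariski-closed. [folklore] -/
theorem isAlgebraicSubgroup_iff_isClosed {H : Subgroup (GL n k)} :
    IsAlgebraicSubgroup H ↔ IsClosed (H : Set (GL n k)) :=
  isClosed_zariski_iff.symm

/-- A self-map of `GL n k` is *polynomial* if each coordinate of `φ g` (matrix entries and
`det⁻¹`) is a polynomial in the coordinates of `g` (a morphism of varieties `GL_n → GL_n`,
Springer 2.1.1–2.1.2). [folklore] -/
def IsPolyMapGL (φ : GL n k → GL n k) : Prop :=
  ∃ P : GLCoord n → MvPolynomial (GLCoord n) k,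
    ∀ (g : GL n k) (c : GLCoord n), glCoordFun (φ g) c = MvPolynomial.eval (glCoordFun g) (P c)

/-- Polynomial maps are Zariski-continuous: the preimage of `𝓥(S)` is `𝓥(S ∘ P)`
(Springer 1.1.3). [folklore] -/
theorem IsPolyMapGL.continuous {φ : GL n k → GL n k} (hφ : IsPolyMapGL φ) : Continuous φ := by
  obtain ⟨P, hP⟩ := hφ
  rw [continuous_iff_isClosed]
  intro Z hZ
  obtain ⟨S, rfl⟩ := isClosed_zariski_iff.1 hZ
  refine isClosed_zariski_iff.2 ⟨MvPolynomial.bind₁ P '' S, Set.ext fun g => ?_⟩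
  simp only [Set.mem_preimage, zeroLocusGL, Set.mem_setOf_eq, Set.forall_mem_image, eval_bind₁]
  refine forall₂_congr fun p _ => ?_
  rw [show (fun c => MvPolynomial.eval (glCoordFun g) (P c)) = glCoordFun (φ g)
    from funext fun c => (hP g c).symm]

/-- The identity is a polynomial map. [folklore] -/
theorem isPolyMapGL_id : IsPolyMapGL (k := k) (n := n) id :=
  ⟨MvPolynomial.X, fun g c => by simp⟩

/-- Constant maps are polynomial. [folklore] -/
theorem isPolyMapGL_const (h : GL n k) : IsPolyMapGL fun _ : GL n k => h :=
  ⟨fun c => MvPolynomial.C (glCoordFun h c), fun g c => by simp⟩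

/-- The pointwise product of polynomial maps is polynomial (Springer 2.1.4: multiplication is a
morphism, coordinates `mulPolyGL`). [folklore] -/
theorem IsPolyMapGL.mul {φ ψ : GL n k → GL n k} (hφ : IsPolyMapGL φ) (hψ : IsPolyMapGL ψ) :
    IsPolyMapGL fun g => φ g * ψ g := by
  obtain ⟨P, hP⟩ := hφ
  obtain ⟨Q, hQ⟩ := hψ
  refine ⟨fun c => MvPolynomial.bind₁ (Sum.elim P Q) (mulPolyGL c), fun g c => ?_⟩
  rw [eval_bind₁, ← eval_mulPolyGL]
  congr 2
  funext i
  rcases i with d | d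
  · simp [hP]
  · simp [hQ]

/-- The pointwise inverse of a polynomial map is polynomial (Springer 2.1.4: inversion is a
morphism, coordinates `invPolyGL`). [folklore] -/
theorem IsPolyMapGL.inv {φ : GL n k → GL n k} (hφ : IsPolyMapGL φ) :
    IsPolyMapGL fun g => (φ g)⁻¹ := by
  obtain ⟨P, hP⟩ := hφ
  refine ⟨fun c => MvPolynomial.bind₁ P (invPolyGL c), fun g c => ?_⟩
  rw [eval_bind₁, ← eval_invPolyGL]
  congr 2
  funext d
  rw [hP]

/-- Left translations are Zariski-continuous (Springer 2.1.2). [folklore] -/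
theorem continuous_mul_left_zariski (h : GL n k) : Continuous fun g : GL n k => h * g :=
  ((isPolyMapGL_const h).mul isPolyMapGL_id).continuous

/-- Right translations are Zariski-continuous (Springer 2.1.2). [folklore] -/
theorem continuous_mul_right_zariski (h : GL n k) : Continuous fun g : GL n k => g * h :=
  (isPolyMapGL_id.mul (isPolyMapGL_const h)).continuous

/-- Inversion is Zariski-continuous (Springer 2.1.2). [folklore] -/
theorem continuous_inv_zariski : Continuous fun g : GL n k => g⁻¹ :=
  isPolyMapGL_id.inv.continuous

/-- The commutator with a fixed element, `g ↦ a g a⁻¹ g⁻¹`, is Zariski-continuous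
(Springer 2.2.8, proof). [folklore] -/
theorem continuous_commutatorElement_left_zariski (a : GL n k) :
    Continuous fun g : GL n k => a * g * a⁻¹ * g⁻¹ :=
  ((((isPolyMapGL_const a).mul isPolyMapGL_id).mul (isPolyMapGL_const a⁻¹)).mul
    isPolyMapGL_id.inv).continuous

/-- The commutator with a fixed element, `g ↦ g a g⁻¹ a⁻¹`, is Zariski-continuous
(Springer 2.2.8, proof). [folklore] -/
theorem continuous_commutatorElement_right_zariski (a : GL n k) :
    Continuous fun g : GL n k => g * a * g⁻¹ * a⁻¹ :=
  (((isPolyMapGL_id.mul (isPolyMapGL_const a)).mul isPolyMapGL_id.inv).mul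
    (isPolyMapGL_const a⁻¹)).continuous

/-- Left translation by `h`, as a homeomorphism for the Zariski topology. [folklore] -/
def zariskiMulLeft (h : GL n k) : GL n k ≃ₜ GL n k where
  toEquiv := Equiv.mulLeft h
  continuous_toFun := continuous_mul_left_zariski h
  continuous_invFun := continuous_mul_left_zariski h⁻¹

/-- Right translation by `h`, as a homeomorphism for the Zariski topology. [folklore] -/
def zariskiMulRight (h : GL n k) : GL n k ≃ₜ GL n k where
  toEquiv := Equiv.mulRight h
  continuous_toFun := continuous_mul_right_zariski h
  continuous_invFun := continuous_mul_right_zariski h⁻¹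

/-- `zariskiMulLeft h` is `g ↦ h g`. [folklore] -/
@[simp] lemma zariskiMulLeft_apply (h g : GL n k) : zariskiMulLeft h g = h * g := rfl

/-- `zariskiMulRight h` is `g ↦ g h`. [folklore] -/
@[simp] lemma zariskiMulRight_apply (h g : GL n k) : zariskiMulRight h g = g * h := rfl

/-- Points of `GL n k` are Zariski-closed. [folklore] -/
theorem isClosed_singleton_zariski (g : GL n k) : IsClosed ({g} : Set (GL n k)) := by
  refine isClosed_zariski_iff.2
    ⟨Set.range fun c => MvPolynomial.X c - MvPolynomial.C (glCoordFun g c), Set.ext fun h => ?_⟩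
  simp only [Set.mem_singleton_iff, zeroLocusGL, Set.mem_setOf_eq, Set.forall_mem_range, map_sub,
    MvPolynomial.eval_X, MvPolynomial.eval_C, sub_eq_zero]
  exact ⟨fun h' => by simp [h'], fun h' => glCoordFun_injective (funext h')⟩

/-- The Zariski closed sets of `GL n k` satisfy the descending chain condition: `GL n k` is a
Noetherian topological space (Springer 1.1.2–1.2: `k[x_{ij}, det⁻¹]` is Noetherian, and closed
sets correspond injectively and order-reversingly to their vanishing ideals). [folklore] -/
theorem noetherianSpace_zariskiGL : TopologicalSpace.NoetherianSpace (GL n k) := by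
  refine ((TopologicalSpace.noetherianSpace_TFAE (GL n k)).out 0 1).mpr ?_
  -- vanishing ideal, an order-reversing injection of closed sets into a Noetherian lattice
  let I : TopologicalSpace.Closeds (GL n k) → (Ideal (MvPolynomial (GLCoord n) k))ᵒᵈ :=
    fun Z => OrderDual.toDual (MvPolynomial.vanishingIdeal k (glCoordFun '' (Z : Set (GL n k))))
  have hI : StrictMono I := by
    intro Z Z' hlt
    obtain ⟨S, hS⟩ := isClosed_zariski_iff.1 Z.isClosed
    obtain ⟨S', hS'⟩ := isClosed_zariski_iff.1 Z'.isClosed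
    have hle : I Z ≤ I Z' := OrderDual.toDual_le_toDual.2
      (MvPolynomial.vanishingIdeal_anti_mono (Set.image_mono (SetLike.coe_subset_coe.2 hlt.le)))
    refine lt_of_le_of_ne hle fun hEq => hlt.ne ?_
    exact TopologicalSpace.Closeds.ext
      (eq_of_vanishingIdeal_eq hS hS' (OrderDual.toDual.injective hEq))
  exact hI.wellFoundedLT

end Zariski



/-! ### Zariski-connected algebraic subgroups are irreducible (Springer 2.2.1) -/

section Irreducible

attribute [local instance] zariskiTopologyGL

/-- Left translates of irreducible subsets of `GL n k` are irreducible. [folklore] -/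
lemma IsIrreducible.smul_zariski {Z : Set (GL n k)} (hZ : IsIrreducible Z) (h : GL n k) :
    IsIrreducible (h • Z) := by
  rw [← Set.image_smul]
  exact hZ.image _ (continuous_mul_left_zariski h).continuousOn

/-- A non-empty irreducible subset of `GL n k` has a prime vanishing ideal (Springer 1.2.5:
irreducible closed sets correspond to prime ideals). [folklore] -/
theorem isPrime_vanishingIdeal_of_isIrreducible {Z : Set (GL n k)} (hZ : IsIrreducible Z) :
    (MvPolynomial.vanishingIdeal k (glCoordFun '' Z)).IsPrime := by
  rw [Ideal.isPrime_iff]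
  refine ⟨fun htop => ?_, fun {f g} hfg => ?_⟩
  · obtain ⟨x, hx⟩ := hZ.nonempty
    have h1 : (1 : MvPolynomial (GLCoord n) k) ∈
        MvPolynomial.vanishingIdeal k (glCoordFun '' Z) := htop ▸ Submodule.mem_top
    have := mem_vanishingIdeal_glCoordFun_iff.1 h1 x hx
    simp at this
  · have hsub : Z ⊆ zeroLocusGL {f} ∪ zeroLocusGL {g} := by
      intro x hx
      have h0 := mem_vanishingIdeal_glCoordFun_iff.1 hfg x hx
      rw [map_mul, mul_eq_zero] at h0
      rcases h0 with h0 | h0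
      · exact Or.inl fun p hp => by rw [Set.mem_singleton_iff.1 hp, h0]
      · exact Or.inr fun p hp => by rw [Set.mem_singleton_iff.1 hp, h0]
    rcases isPreirreducible_iff_isClosed_union_isClosed.1 hZ.2 _ _ (isClosed_zeroLocusGL {f})
      (isClosed_zeroLocusGL {g}) hsub with h | h
    · exact Or.inl (mem_vanishingIdeal_glCoordFun_iff.2 fun x hx => h hx f rfl)
    · exact Or.inr (mem_vanishingIdeal_glCoordFun_iff.2 fun x hx => h hx g rfl)

/-- **A Zariski-connected algebraic subgroup of `GL n k` is irreducible** (Springer 2.2.1 (i) and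
its proof: the irreducible component `H°` through `e` is a closed subgroup of finite index, so a
closed subgroup without proper closed finite-index subgroups is irreducible). Proof: `H` is a
finite union of irreducible closed subsets (the Zariski topology is Noetherian); `H` permutes its
maximal irreducible subsets by left translation; the stabiliser of one of them, `X₁`, is a closed
subgroup of finite index, hence all of `H`, and then `H = X₁ x₁⁻¹` is irreducible.
[cite: SpringerLAG1998, 2.2.1 (i)] -/
theorem IsZConnected.isIrreducible {H : Subgroup (GL n k)} (hH : IsZConnected H) :
    IsIrreducible (H : Set (GL n k)) := by
  haveI := noetherianSpace_zariskiGL (k := k) (n := n)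
  have hHcl : IsClosed (H : Set (GL n k)) := hH.1.isClosed
  obtain ⟨S, hSfin, hScl, hSirr, hHS⟩ :=
    TopologicalSpace.NoetherianSpace.exists_finite_set_isClosed_irreducible hHcl
  -- every irreducible subset of `H` lies in a member of `S`
  have hsub : ∀ Y ⊆ (H : Set (GL n k)), IsIrreducible Y → ∃ t ∈ S, Y ⊆ t := by
    intro Y hY hYirr
    obtain ⟨t, ht, hYt⟩ := isIrreducible_iff_sUnion_isClosed.1 hYirr hSfin.toFinset
      (fun t ht => hScl t (hSfin.mem_toFinset.1 ht)) (by rwa [hSfin.coe_toFinset, ← hHS])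
    exact ⟨t, hSfin.mem_toFinset.1 ht, hYt⟩
  have hSH : ∀ t ∈ S, t ⊆ (H : Set (GL n k)) := fun t ht =>
    hHS ▸ Set.subset_sUnion_of_mem ht
  -- the maximal irreducible subsets of `H`
  set 𝒞 : Set (Set (GL n k)) := {X | X ⊆ H ∧ IsIrreducible X ∧
    ∀ Y : Set (GL n k), Y ⊆ H → IsIrreducible Y → X ⊆ Y → Y = X} with h𝒞
  have h𝒞S : 𝒞 ⊆ S := by
    rintro X ⟨hXH, hXirr, hXmax⟩
    obtain ⟨t, ht, hXt⟩ := hsub X hXH hXirr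
    rwa [← hXmax t (hSH t ht) (hSirr t ht) hXt]
  -- `𝒞` is non-empty: a maximal member of `S` belongs to it
  have hSne : S.Nonempty := by
    by_contra hS
    rw [Set.not_nonempty_iff_eq_empty] at hS
    have h1 : (1 : GL n k) ∈ (H : Set (GL n k)) := H.one_mem
    rw [hHS, hS, Set.sUnion_empty] at h1
    exact h1
  obtain ⟨X₁, hX₁max⟩ := hSfin.exists_maximal hSne
  have hX₁S : X₁ ∈ S := hX₁max.1
  have hX₁𝒞 : X₁ ∈ 𝒞 := by
    refine ⟨hSH X₁ hX₁S, hSirr X₁ hX₁S, fun Y hYH hYirr hX₁Y => ?_⟩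
    obtain ⟨t, ht, hYt⟩ := hsub Y hYH hYirr
    have htX₁ : t ⊆ X₁ := hX₁max.2 ht (hX₁Y.trans hYt)
    exact Set.Subset.antisymm (hYt.trans htX₁) hX₁Y
  -- `H` permutes `𝒞` by left translation
  have hsmul : ∀ h ∈ H, ∀ X ∈ 𝒞, h • X ∈ 𝒞 := by
    rintro h hh X ⟨hXH, hXirr, hXmax⟩
    refine ⟨?_, IsIrreducible.smul_zariski hXirr h, fun Y hYH hYirr hXY => ?_⟩
    · rintro _ ⟨x, hx, rfl⟩
      exact H.mul_mem hh (hXH hx)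
    · have hY' : h⁻¹ • Y = X := by
        refine hXmax (h⁻¹ • Y) ?_ (IsIrreducible.smul_zariski hYirr h⁻¹) ?_
        · rintro _ ⟨y, hy, rfl⟩
          exact H.mul_mem (H.inv_mem hh) (hYH hy)
        · rw [← inv_smul_smul h X]
          exact Set.smul_set_mono hXY
      rw [← hY', smul_inv_smul]
  -- the stabiliser of `X₁` in `H`
  set K : Subgroup (GL n k) := (MulAction.stabilizer ↥H X₁).map H.subtype with hK
  have hKH : K ≤ H := Subgroup.map_subtype_le _
  have hmemK : ∀ g : GL n k, g ∈ K ↔ g ∈ H ∧ ∀ x ∈ X₁, g * x ∈ X₁ := by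
    intro g
    constructor
    · rintro ⟨g', hg', rfl⟩
      refine ⟨g'.2, fun x hx => ?_⟩
      have hEq : (g' : GL n k) • X₁ = X₁ := hg'
      rw [← hEq]
      exact Set.smul_mem_smul_set hx
    · rintro ⟨hg, hgX⟩
      refine ⟨⟨g, hg⟩, ?_, rfl⟩
      obtain ⟨-, -, hmax⟩ := hsmul g hg X₁ hX₁𝒞
      have hsub' : g • X₁ ⊆ X₁ := by
        rintro _ ⟨x, hx, rfl⟩
        exact hgX x hx
      have hEq : X₁ = g • X₁ := hmax X₁ hX₁𝒞.1 hX₁𝒞.2.1 hsub'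
      change (⟨g, hg⟩ : ↥H) ∈ MulAction.stabilizer (↥H) X₁
      rw [MulAction.mem_stabilizer_iff, Subgroup.mk_smul]
      exact hEq.symm
  have hKalg : IsAlgebraicSubgroup K := by
    rw [isAlgebraicSubgroup_iff_isClosed]
    have hKset : (K : Set (GL n k)) =
        (H : Set (GL n k)) ∩ ⋂ x ∈ X₁, (fun g => g * x) ⁻¹' X₁ := by
      ext g
      simp only [SetLike.mem_coe, hmemK, Set.mem_inter_iff, Set.mem_iInter, Set.mem_preimage]
    rw [hKset]
    exact hHcl.inter (isClosed_biInter fun x _ =>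
      (hScl X₁ hX₁S).preimage (continuous_mul_right_zariski x))
  have hKfi : (K.subgroupOf H).FiniteIndex := by
    rw [hK, Subgroup.subgroupOf, Subgroup.comap_map_eq_self_of_injective H.subtype_injective]
    have horb : MulAction.orbit ↥H X₁ ⊆ S := by
      rintro _ ⟨h, rfl⟩
      exact h𝒞S (hsmul h h.2 X₁ hX₁𝒞)
    haveI : Finite ↥(MulAction.orbit ↥H X₁) := (hSfin.subset horb).to_subtype
    haveI : Finite (↥H ⧸ MulAction.stabilizer ↥H X₁) :=
      Finite.of_equiv _ (MulAction.orbitEquivQuotientStabilizer ↥H X₁)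
    exact Subgroup.finiteIndex_of_finite_quotient
  -- so `K = H`: `H` stabilises `X₁`
  have hKeq : K = H := hH.2 K hKH hKalg hKfi
  obtain ⟨x₁, hx₁⟩ := (hSirr X₁ hX₁S).nonempty
  have hHX : (H : Set (GL n k)) = (fun g => g * x₁⁻¹) '' X₁ := by
    refine Set.Subset.antisymm (fun h hh => ?_) ?_
    · have hhK : h ∈ K := hKeq.symm ▸ hh
      exact ⟨h * x₁, ((hmemK h).1 hhK).2 x₁ hx₁, by simp⟩
    · rintro _ ⟨x, hx, rfl⟩
      exact H.mul_mem (hSH X₁ hX₁S hx) (H.inv_mem (hSH X₁ hX₁S hx₁))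
  rw [hHX]
  exact (hSirr X₁ hX₁S).image _ (continuous_mul_right_zariski x₁⁻¹).continuousOn

/-- Hence the vanishing ideal of a Zariski-connected algebraic subgroup is prime
(Springer 2.2.1 (i) with 1.2.5). [cite: SpringerLAG1998, 2.2.1 (i)] -/
theorem IsZConnected.isPrime_vanishingIdeal {H : Subgroup (GL n k)} (hH : IsZConnected H) :
    (MvPolynomial.vanishingIdeal k (glCoordFun '' (H : Set (GL n k)))).IsPrime :=
  isPrime_vanishingIdeal_of_isIrreducible hH.isIrreducible

end Irreducible

/-! ### Chains of connected algebraic subgroups and the existence of Borel subgroups -/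

section Chains

attribute [local instance] zariskiTopologyGL

variable {H H' : Subgroup (GL n k)}

/-- The point of `Spec k[x_{ij}, det⁻¹]` defined by a Zariski-connected algebraic subgroup: its
(prime) vanishing ideal (Springer 1.2.5, 2.2.1). [folklore] -/
noncomputable def IsZConnected.primePoint (hH : IsZConnected H) :
    PrimeSpectrum (MvPolynomial (GLCoord n) k) :=
  ⟨MvPolynomial.vanishingIdeal k (glCoordFun '' (H : Set (GL n k))), hH.isPrime_vanishingIdeal⟩

/-- The ideal of `primePoint` is the vanishing ideal. [folklore] -/
@[simp] lemma IsZConnected.primePoint_asIdeal (hH : IsZConnected H) :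
    hH.primePoint.asIdeal = MvPolynomial.vanishingIdeal k (glCoordFun '' (H : Set (GL n k))) := rfl

/-- Passing to vanishing ideals reverses strict inclusions of connected algebraic subgroups
(Springer 1.1.2–1.1.3). [folklore] -/
theorem IsZConnected.primePoint_lt_of_lt (hH : IsZConnected H) (hH' : IsZConnected H')
    (hlt : H < H') : hH'.primePoint < hH.primePoint := by
  rw [← PrimeSpectrum.asIdeal_lt_asIdeal, IsZConnected.primePoint_asIdeal,
    IsZConnected.primePoint_asIdeal]
  refine lt_of_le_of_ne (MvPolynomial.vanishingIdeal_anti_mono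
    (Set.image_mono (SetLike.coe_subset_coe.2 hlt.le))) fun hEq => hlt.ne ?_
  obtain ⟨S, hS⟩ := hH.1
  obtain ⟨S', hS'⟩ := hH'.1
  exact SetLike.coe_injective (eq_of_vanishingIdeal_eq hS hS' hEq.symm)

omit [DecidableEq n] in
/-- The coordinate ring `k[x_{ij}, det⁻¹]` of `GL n k` — here the polynomial ring in the
`n² + 1` coordinates `GLCoord n` — has Krull dimension `n² + 1` (Mathlib:
`MvPolynomial.ringKrullDim_of_isNoetherianRing`). [folklore] -/
theorem ringKrullDim_mvPolynomial_glCoord :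
    ringKrullDim (MvPolynomial (GLCoord n) k) = (Nat.card (GLCoord n) : WithBot ℕ∞) := by
  rw [MvPolynomial.ringKrullDim_of_isNoetherianRing, ringKrullDim_eq_zero_of_field, zero_add]

/-- The vanishing ideal of a connected algebraic subgroup has finite height (at most `n² + 1`).
[folklore] -/
theorem IsZConnected.height_primePoint_lt_top (hH : IsZConnected H) :
    Order.height hH.primePoint < ⊤ := by
  have h1 := Order.height_le_krullDim hH.primePoint
  have h2 : Order.krullDim (PrimeSpectrum (MvPolynomial (GLCoord n) k)) =
      (Nat.card (GLCoord n) : WithBot ℕ∞) := ringKrullDim_mvPolynomial_glCoord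
  rw [h2] at h1
  have h3 : Order.height hH.primePoint ≤ (Nat.card (GLCoord n) : ℕ∞) := by exact_mod_cast h1
  exact lt_of_le_of_lt h3 (ENat.coe_lt_top _)

/-- The *height* of a connected algebraic subgroup `H ≤ GL n k`: the height of its prime
vanishing ideal, a natural number `≤ n² + 1` playing the role of `n² + 1 - dim H`
(Springer 1.8.1–1.8.2). [folklore] -/
noncomputable def IsZConnected.primeHeight (hH : IsZConnected H) : ℕ :=
  (Order.height hH.primePoint).toNat

/-- **Strictly larger connected algebraic subgroups have strictly smaller height** (the
algebraic counterpart of Springer 1.8.2: a proper closed irreducible subvariety has strictly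
smaller dimension). Consequently every strictly ascending chain of connected algebraic subgroups
of `GL n k` has length `≤ n² + 1`. [folklore] -/
theorem IsZConnected.primeHeight_lt_of_lt (hH : IsZConnected H) (hH' : IsZConnected H')
    (hlt : H < H') : hH'.primeHeight < hH.primeHeight := by
  have hfin := hH.height_primePoint_lt_top
  have hfin' := hH'.height_primePoint_lt_top
  have hlt' := Order.height_strictMono (hH.primePoint_lt_of_lt hH' hlt) hfin'
  unfold IsZConnected.primeHeight
  have e := ENat.coe_toNat hfin.ne
  have e' := ENat.coe_toNat hfin'.ne
  rw [← e, ← e'] at hlt'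
  exact_mod_cast hlt'

/-- **Every connected solvable algebraic subgroup `H` of `G ≤ GL n k` lies in a Borel subgroup of
`G`** — a maximal connected solvable algebraic subgroup (Springer 6.2, definition of Borel
subgroups before 6.2.7: *such subgroups exist (take one of maximal dimension)*; 1.8.2). Proof: a
connected solvable algebraic `B` with `H ≤ B ≤ G` of minimal height is maximal, by
`IsZConnected.primeHeight_lt_of_lt`.
[cite: SpringerLAG1998, 6.2 (definition of Borel subgroups) and 1.8.2] -/
theorem exists_isBorelIn_ge {G : Subgroup (GL n k)} (hHG : H ≤ G) (hH : IsZConnected H)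
    (hsolv : IsSolvable ↥H) : ∃ B : Subgroup (GL n k), IsBorelIn B G ∧ H ≤ B := by
  classical
  -- heights attained by connected solvable algebraic subgroups between `H` and `G`
  have hex : ∃ m : ℕ, ∃ B : Subgroup (GL n k), ∃ hB : IsZConnected B,
      H ≤ B ∧ B ≤ G ∧ IsSolvable ↥B ∧ hB.primeHeight = m :=
    ⟨_, H, hH, le_rfl, hHG, hsolv, rfl⟩
  obtain ⟨B, hBc, hHB, hBG, hBs, hBm⟩ := Nat.find_spec hex
  refine ⟨B, ⟨hBG, hBc, hBs, fun B' hBB' hB'G hB'c hB's => ?_⟩, hHB⟩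
  by_contra hne
  have hlt : B < B' := lt_of_le_of_ne hBB' (Ne.symm hne)
  have h1 : hB'c.primeHeight < hBc.primeHeight := hBc.primeHeight_lt_of_lt hB'c hlt
  have h2 : Nat.find hex ≤ hB'c.primeHeight :=
    Nat.find_min' hex ⟨B', hB'c, hHB.trans hBB', hB'G, hB's, rfl⟩
  omega

/-- In particular a subtorus of `G` lies in a Borel subgroup of `G` (Springer 6.4.1, proof: *a
maximal torus, being connected and solvable, lies in some Borel group*).
[cite: SpringerLAG1998, 6.4.1, proof] -/
theorem IsTorusSubgroup.exists_isBorelIn_ge {G T : Subgroup (GL n k)} (hT : IsTorusSubgroup T)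
    (hTG : T ≤ G) : ∃ B : Subgroup (GL n k), IsBorelIn B G ∧ T ≤ B := by
  haveI : IsMulCommutative ↥T := hT.2.1
  exact Literature.NumberTheory.Automorphic.exists_isBorelIn_ge hTG hT.1
    (isSolvable_of_comm fun a b => IsMulCommutative.is_comm.comm a b)

end Chains

/-! ### Zariski closures of subgroups (Springer 2.2.4 (i), 2.2.6 (i)) -/

section Closure

attribute [local instance] zariskiTopologyGL

/-- The image of the closure of `s` under a continuous map that sends `s` into a closed set `t`
lies in `t`. [folklore] -/
lemma image_closure_subset_of_isClosed {φ : GL n k → GL n k} (hφ : Continuous φ)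
    {s t : Set (GL n k)} (ht : IsClosed t) (hst : Set.MapsTo φ s t) :
    Set.MapsTo φ (closure s) t :=
  (hst.closure hφ).mono_right ht.closure_subset

/-- The **Zariski closure** of a subgroup `A ≤ GL n k`, a subgroup (Springer 2.2.4 (i): *the
closure `H̄` of a subgroup `H` is a subgroup*; the proof uses only that translations and
inversion are homeomorphisms). [cite: SpringerLAG1998, 2.2.4 (i)] -/
def zariskiClosure (A : Subgroup (GL n k)) : Subgroup (GL n k) where
  carrier := closure (A : Set (GL n k))
  one_mem' := subset_closure A.one_mem
  mul_mem' := by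
    -- first `a ȳ ∈ Ā` for `a ∈ A`, then `x̄ ȳ ∈ Ā`
    have h1 : ∀ a ∈ A, Set.MapsTo (fun g => a * g) (closure (A : Set (GL n k)))
        (closure (A : Set (GL n k))) := fun a ha =>
      image_closure_subset_of_isClosed (continuous_mul_left_zariski a) isClosed_closure
        fun g hg => subset_closure (A.mul_mem ha hg)
    intro x y hx hy
    exact image_closure_subset_of_isClosed (continuous_mul_right_zariski y) isClosed_closure
      (fun g hg => h1 g hg hy) hx
  inv_mem' := by
    intro x hx
    exact image_closure_subset_of_isClosed continuous_inv_zariski isClosed_closure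
      (fun g hg => subset_closure (A.inv_mem hg)) hx

/-- The underlying set of `zariskiClosure A` is the topological closure of `A`. [folklore] -/
@[simp] lemma coe_zariskiClosure (A : Subgroup (GL n k)) :
    (zariskiClosure A : Set (GL n k)) = closure (A : Set (GL n k)) := rfl

/-- Membership in `zariskiClosure A`. [folklore] -/
lemma mem_zariskiClosure_iff {A : Subgroup (GL n k)} {g : GL n k} :
    g ∈ zariskiClosure A ↔ g ∈ closure (A : Set (GL n k)) := Iff.rfl

/-- `A ≤ Ā`. [folklore] -/
theorem le_zariskiClosure (A : Subgroup (GL n k)) : A ≤ zariskiClosure A :=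
  fun _ hg => subset_closure hg

/-- `Ā` is an algebraic subgroup. [folklore] -/
theorem isAlgebraicSubgroup_zariskiClosure (A : Subgroup (GL n k)) :
    IsAlgebraicSubgroup (zariskiClosure A) :=
  isAlgebraicSubgroup_iff_isClosed.2 isClosed_closure

/-- `Ā` is the smallest algebraic subgroup containing `A`. [folklore] -/
theorem zariskiClosure_le {A K : Subgroup (GL n k)} (hK : IsAlgebraicSubgroup K)
    (hAK : A ≤ K) : zariskiClosure A ≤ K := fun _ hg =>
  (closure_minimal (SetLike.coe_subset_coe.2 hAK) hK.isClosed : closure (A : Set (GL n k)) ⊆ K) hg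

/-- Closure is monotone. [folklore] -/
theorem zariskiClosure_mono {A B : Subgroup (GL n k)} (h : A ≤ B) :
    zariskiClosure A ≤ zariskiClosure B :=
  zariskiClosure_le (isAlgebraicSubgroup_zariskiClosure B) (h.trans (le_zariskiClosure B))

/-- An algebraic subgroup is its own closure. [folklore] -/
theorem IsAlgebraicSubgroup.zariskiClosure_eq {A : Subgroup (GL n k)} (hA : IsAlgebraicSubgroup A) :
    zariskiClosure A = A :=
  le_antisymm (zariskiClosure_le hA le_rfl) (le_zariskiClosure A)

/-- The closure of the trivial subgroup is trivial (points are closed). [folklore] -/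
@[simp] theorem zariskiClosure_bot : zariskiClosure (⊥ : Subgroup (GL n k)) = ⊥ :=
  isAlgebraicSubgroup_bot.zariskiClosure_eq

/-- A connected algebraic subgroup of `Ā` lies in every algebraic finite-index subgroup of `Ā`
(Springer 2.2.1 (iii)). [folklore] -/
lemma IsZConnected.le_of_finiteIndex {H L K : Subgroup (GL n k)} (hH : IsZConnected H)
    (hHL : H ≤ L) (hKalg : IsAlgebraicSubgroup K) (hKfi : (K.subgroupOf L).FiniteIndex) :
    H ≤ K := by
  have hHK : H ⊓ K = H := by
    refine hH.2 (H ⊓ K) inf_le_left (hH.1.inf hKalg) ⟨?_⟩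
    change (H ⊓ K).relIndex H ≠ 0
    rw [inf_comm, Subgroup.inf_relIndex_right]
    intro h0
    exact hKfi.index_ne_zero (Subgroup.relIndex_eq_zero_of_le_right hHL h0)
  exact inf_eq_left.1 hHK

/-- **Springer 2.2.6 (i) / 2.2.7 (i), closure form: the smallest algebraic subgroup containing two
connected algebraic subgroups is connected.** (Springer proves more — the abstract subgroup
generated is already closed — using 1.9.5; the closure form needs only 2.2.1 (iii): an algebraic
finite-index subgroup of the closure meets each `Hᵢ` in an algebraic finite-index subgroup of
`Hᵢ`, hence contains `Hᵢ`.) [cite: SpringerLAG1998, 2.2.6 (i)] -/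
theorem isZConnected_zariskiClosure_sup {H₁ H₂ : Subgroup (GL n k)} (h₁ : IsZConnected H₁)
    (h₂ : IsZConnected H₂) : IsZConnected (zariskiClosure (H₁ ⊔ H₂)) := by
  refine ⟨isAlgebraicSubgroup_zariskiClosure (H₁ ⊔ H₂), fun K hK hKalg hKfi => le_antisymm hK ?_⟩
  refine zariskiClosure_le hKalg (sup_le ?_ ?_)
  · exact h₁.le_of_finiteIndex (le_sup_left.trans (le_zariskiClosure (H₁ ⊔ H₂))) hKalg hKfi
  · exact h₂.le_of_finiteIndex (le_sup_right.trans (le_zariskiClosure (H₁ ⊔ H₂))) hKalg hKfi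

/-- **Commutators of closures lie in the closure of the commutator**: `(Ā, B̄) ⊆ cl (A, B)`
(the argument of Springer 2.2.4 applied to the continuous maps `y ↦ a y a⁻¹ y⁻¹` and
`x ↦ x y x⁻¹ y⁻¹`, 2.2.8). [folklore] -/
theorem commutator_zariskiClosure_le (A B : Subgroup (GL n k)) :
    ⁅zariskiClosure A, zariskiClosure B⁆ ≤ zariskiClosure ⁅A, B⁆ := by
  rw [Subgroup.commutator_le]
  have hC : IsClosed ((zariskiClosure ⁅A, B⁆ : Subgroup (GL n k)) : Set (GL n k)) :=
    isClosed_closure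
  -- `a ∈ A`, `y ∈ B̄`
  have h1 : ∀ a ∈ A, Set.MapsTo (fun y => a * y * a⁻¹ * y⁻¹) (closure (B : Set (GL n k)))
      ((zariskiClosure ⁅A, B⁆ : Subgroup (GL n k)) : Set (GL n k)) := fun a ha =>
    image_closure_subset_of_isClosed (continuous_commutatorElement_left_zariski a) hC
      fun y hy => subset_closure (Subgroup.commutator_mem_commutator ha hy)
  intro x hx y hy
  exact image_closure_subset_of_isClosed (continuous_commutatorElement_right_zariski y) hC
    (fun a ha => h1 a ha hy) hx

/-- **The closure of a solvable subgroup is solvable** (Borel, *Linear Algebraic Groups*, I.2.4;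
from `commutator_zariskiClosure_le` by induction along the derived series).
[folklore] -/
theorem isSolvable_zariskiClosure {A : Subgroup (GL n k)} (hA : IsSolvable ↥A) :
    IsSolvable ↥(zariskiClosure A) := by
  -- the derived series of `A` and `Ā`, as subgroups of `GL n k`
  have key : ∀ m : ℕ, (derivedSeries ↥(zariskiClosure A) m).map (zariskiClosure A).subtype ≤
      zariskiClosure ((derivedSeries ↥A m).map A.subtype) := by
    intro m
    induction m with
    | zero =>
      simp only [derivedSeries_zero, ← MonoidHom.range_eq_map, Subgroup.range_subtype]
      exact le_rfl
    | succ m ih =>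
      rw [derivedSeries_succ, derivedSeries_succ, Subgroup.map_commutator, Subgroup.map_commutator]
      exact (Subgroup.commutator_mono ih ih).trans (commutator_zariskiClosure_le _ _)
  obtain ⟨m, hm⟩ := hA
  refine ⟨⟨m, ?_⟩⟩
  have h := key m
  rw [hm, Subgroup.map_bot, zariskiClosure_bot, le_bot_iff,
    Subgroup.map_eq_bot_iff_of_injective _ (zariskiClosure A).subtype_injective] at h
  exact h

end Closure

/-! ### Translates of closed sets -/

section Converse

attribute [local instance] zariskiTopologyGL

/-- Left translates of Zariski-closed sets are closed. [folklore] -/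
lemma isClosed_smul_zariski {Z : Set (GL n k)} (hZ : IsClosed Z) (g : GL n k) :
    IsClosed (g • Z) := by
  rw [← Set.image_smul]
  exact (zariskiMulLeft g).isClosed_image.2 hZ

end Converse

section ClosureFamilies

/-- **Springer 2.2.6 (i), closure form, for families:** the smallest algebraic subgroup containing
a family of connected algebraic subgroups is connected. [cite: SpringerLAG1998, 2.2.6 (i)] -/
theorem isZConnected_zariskiClosure_iSup {ι : Sort*} {H : ι → Subgroup (GL n k)}
    (h : ∀ i, IsZConnected (H i)) : IsZConnected (zariskiClosure (⨆ i, H i)) := by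
  refine ⟨isAlgebraicSubgroup_zariskiClosure _, fun K hK hKalg hKfi => le_antisymm hK ?_⟩
  refine zariskiClosure_le hKalg (iSup_le fun i => ?_)
  exact (h i).le_of_finiteIndex ((le_iSup H i).trans (le_zariskiClosure _)) hKalg hKfi

/-- A connected algebraic subgroup is the closure of itself, so `zariskiClosure` of a connected
algebraic subgroup is connected. [folklore] -/
theorem IsZConnected.zariskiClosure_eq {H : Subgroup (GL n k)} (hH : IsZConnected H) :
    zariskiClosure H = H :=
  hH.1.zariskiClosure_eq

end ClosureFamilies

section Images

variable {m : Type*} [Fintype m] [DecidableEq m]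

/-- **The closure of the image of a connected algebraic subgroup under an algebraic homomorphism is
connected** (Springer 2.2.5 (ii), (iv) in closure form: there `φ(G)` is shown to be closed using
1.9.5, and `φ(G°) = φ(G)°`; the closure form needs only 2.2.1 (iii): the preimage of an algebraic
finite-index subgroup of the closure is an algebraic finite-index subgroup of `H`).
[cite: SpringerLAG1998, 2.2.5 (iv)] -/
theorem IsZConnected.zariskiClosure_range {G H : Subgroup (GL n k)} {f : ↥G →* GL m k}
    (hf : MonoidHom.IsAlgebraicGL f) (hH : IsZConnected H) (hHG : H ≤ G) :
    IsZConnected (zariskiClosure (f.comp (Subgroup.inclusion hHG)).range) := by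
  set ψ : ↥H →* GL m k := f.comp (Subgroup.inclusion hHG) with hψ
  refine ⟨isAlgebraicSubgroup_zariskiClosure _, fun K hK hKalg hKfi => le_antisymm hK ?_⟩
  obtain ⟨P, hP⟩ := hf
  obtain ⟨S', hS'⟩ := hKalg
  obtain ⟨S, hS⟩ := hH.1
  -- the preimage `L` of `K` in `H`
  set L : Subgroup (GL n k) := (K.comap ψ).map H.subtype with hL
  have hLH : L ≤ H := Subgroup.map_subtype_le _
  have hmemL : ∀ g : GL n k, g ∈ L ↔ ∃ hg : g ∈ H, ψ ⟨g, hg⟩ ∈ K := by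
    intro g
    constructor
    · rintro ⟨g', hg', rfl⟩
      exact ⟨g'.2, hg'⟩
    · rintro ⟨hg, hgK⟩
      exact ⟨⟨g, hg⟩, hgK, rfl⟩
  have hLalg : IsAlgebraicSubgroup L := by
    refine ⟨S ∪ MvPolynomial.bind₁ P '' S', Set.ext fun g => ?_⟩
    rw [zeroLocusGL_union, SetLike.mem_coe, hmemL, Set.mem_inter_iff, ← hS, SetLike.mem_coe]
    constructor
    · rintro ⟨hg, hgK⟩
      refine ⟨hg, ?_⟩
      rw [← SetLike.mem_coe, hS'] at hgK
      simp only [zeroLocusGL, Set.mem_setOf_eq, Set.forall_mem_image, eval_bind₁] at hgK ⊢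
      intro p hp
      rw [show (fun c => MvPolynomial.eval (glCoordFun g) (P c)) = glCoordFun (ψ ⟨g, hg⟩) from
        funext fun c => (hP (Subgroup.inclusion hHG ⟨g, hg⟩) c).symm]
      exact hgK p hp
    · rintro ⟨hg, hgZ⟩
      refine ⟨hg, ?_⟩
      rw [← SetLike.mem_coe, hS']
      simp only [zeroLocusGL, Set.mem_setOf_eq, Set.forall_mem_image, eval_bind₁] at hgZ ⊢
      intro p hp
      rw [← show (fun c => MvPolynomial.eval (glCoordFun g) (P c)) = glCoordFun (ψ ⟨g, hg⟩) from
        funext fun c => (hP (Subgroup.inclusion hHG ⟨g, hg⟩) c).symm]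
      exact hgZ hp
  have hLfi : (L.subgroupOf H).FiniteIndex := by
    rw [hL, Subgroup.subgroupOf, Subgroup.comap_map_eq_self_of_injective H.subtype_injective]
    refine ⟨?_⟩
    rw [Subgroup.index_comap]
    intro h0
    exact hKfi.index_ne_zero
      (Subgroup.relIndex_eq_zero_of_le_right (le_zariskiClosure ψ.range) h0)
  -- so `L = H`, i.e. `ψ(H) ≤ K`
  have hLeq : L = H := hH.2 L hLH hLalg hLfi
  refine zariskiClosure_le ⟨S', hS'⟩ ?_
  rintro _ ⟨h, rfl⟩
  have hhL : (h : GL n k) ∈ L := hLeq.symm ▸ h.2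
  obtain ⟨hh, hK'⟩ := (hmemL _).1 hhL
  exact hK'

end Images

/-! ### Groups generated by irreducible subsets; the commutator subgroup (Springer 2.2.6, 2.2.8) -/

section Generation

attribute [local instance] zariskiTopologyGL

/-- **An irreducible subset through `e` of an algebraic group `L` lies in every algebraic subgroup
of finite index** (Springer 2.2.1 (ii)–(iii): such a subgroup `K` is open and closed and `L` is
the finite disjoint union of the closed cosets `x K`; an irreducible `X ⊆ L` lies in one coset,
which is `K` if `e ∈ X`). [cite: SpringerLAG1998, 2.2.1] -/
theorem IsIrreducible.subset_of_finiteIndex {X : Set (GL n k)} (hX : IsIrreducible X)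
    (h1 : (1 : GL n k) ∈ X) {L K : Subgroup (GL n k)} (hXL : X ⊆ L)
    (hKalg : IsAlgebraicSubgroup K) (hKfi : (K.subgroupOf L).FiniteIndex) : X ⊆ K := by
  classical
  haveI := hKfi
  set Q := ↥L ⧸ K.subgroupOf L
  haveI : Finite Q := Subgroup.finite_quotient_of_finiteIndex
  haveI : Fintype Q := Fintype.ofFinite Q
  let C : Q → Set (GL n k) := fun q => ((q.out : ↥L) : GL n k) • (K : Set (GL n k))
  have hCcl : ∀ q, IsClosed (C q) := fun q => isClosed_smul_zariski hKalg.isClosed _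
  have hcover : X ⊆ ⋃₀ ↑(Finset.univ.image C) := by
    intro x hx
    obtain ⟨y, hy⟩ := QuotientGroup.mk_out_eq_mul (K.subgroupOf L) (⟨x, hXL hx⟩ : ↥L)
    refine Set.mem_sUnion.2 ⟨C (QuotientGroup.mk ⟨x, hXL hx⟩), by simp, ?_⟩
    refine ⟨((y : ↥L) : GL n k)⁻¹, K.inv_mem (Subgroup.mem_subgroupOf.1 y.2), ?_⟩
    change ((QuotientGroup.mk (s := K.subgroupOf L) (⟨x, hXL hx⟩ : ↥L)).out : GL n k) *
      ((y : ↥L) : GL n k)⁻¹ = x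
    rw [hy]
    simp
  obtain ⟨_, hq, hXq⟩ := isIrreducible_iff_sUnion_isClosed.1 hX (Finset.univ.image C)
    (by simpa using hCcl) hcover
  obtain ⟨q, -, rfl⟩ := Finset.mem_image.1 hq
  -- `1 ∈ g K` forces `g ∈ K`, so `g K = K ⊇ X`
  obtain ⟨x, hxK, hx1⟩ := hXq h1
  have hg : ((q.out : ↥L) : GL n k) ∈ K := by
    have : ((q.out : ↥L) : GL n k) = x⁻¹ := eq_inv_of_mul_eq_one_left hx1
    rw [this]
    exact K.inv_mem hxK
  intro y hy
  obtain ⟨z, hzK, rfl⟩ := hXq hy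
  exact K.mul_mem hg hzK

/-- **Springer 2.2.6 (i), closure form: the smallest algebraic subgroup containing a family of
irreducible subsets through `e` is connected.** (Springer shows that the abstract subgroup
generated is itself closed, using 1.9.5; the closure form needs only 2.2.1.)
[cite: SpringerLAG1998, 2.2.6 (i)] -/
theorem isZConnected_zariskiClosure_closure_sUnion {𝓧 : Set (Set (GL n k))}
    (hirr : ∀ X ∈ 𝓧, IsIrreducible X) (h1 : ∀ X ∈ 𝓧, (1 : GL n k) ∈ X) :
    IsZConnected (zariskiClosure (Subgroup.closure (⋃₀ 𝓧))) := by
  refine ⟨isAlgebraicSubgroup_zariskiClosure _, fun K hK hKalg hKfi => le_antisymm hK ?_⟩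
  refine zariskiClosure_le hKalg ((Subgroup.closure_le K).2 ?_)
  intro x hx
  obtain ⟨X, hX, hxX⟩ := Set.mem_sUnion.1 hx
  have hXL : X ⊆ zariskiClosure (Subgroup.closure (⋃₀ 𝓧)) := fun y hy =>
    le_zariskiClosure _ (Subgroup.subset_closure (Set.subset_sUnion_of_mem hX hy))
  exact IsIrreducible.subset_of_finiteIndex (hirr X hX) (h1 X hX) hXL hKalg hKfi hxX

/-- **Springer 2.2.8, closure form: the commutator group `(G, H)` of a connected `G` with any
subgroup `H` has connected closure** — it is generated by the irreducible subsets
`{g h g⁻¹ h⁻¹ | g ∈ G}` (`h ∈ H`), images of `G` under the morphisms `g ↦ g h g⁻¹ h⁻¹`, each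
containing `e`. [cite: SpringerLAG1998, 2.2.8] -/
theorem IsZConnected.isZConnected_zariskiClosure_commutator {G : Subgroup (GL n k)}
    (hG : IsZConnected G) (H : Subgroup (GL n k)) : IsZConnected (zariskiClosure ⁅G, H⁆) := by
  set 𝓧 : Set (Set (GL n k)) :=
    (fun h : GL n k => (fun g : GL n k => g * h * g⁻¹ * h⁻¹) '' (G : Set (GL n k))) '' (H : Set _)
    with h𝓧
  have hgen : ⁅G, H⁆ = Subgroup.closure (⋃₀ 𝓧) := by
    rw [Subgroup.commutator_def]
    congr 1
    ext x
    simp only [Set.mem_setOf_eq, h𝓧, Set.sUnion_image, Set.mem_iUnion, Set.mem_image,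
      SetLike.mem_coe, exists_prop, commutatorElement_def]
    constructor
    · rintro ⟨g, hg, h, hh, rfl⟩
      exact ⟨h, hh, g, hg, rfl⟩
    · rintro ⟨h, hh, g, hg, rfl⟩
      exact ⟨g, hg, h, hh, rfl⟩
  rw [hgen]
  refine isZConnected_zariskiClosure_closure_sUnion ?_ ?_
  · rintro _ ⟨h, -, rfl⟩
    exact hG.isIrreducible.image _ (continuous_commutatorElement_right_zariski h).continuousOn
  · rintro _ ⟨h, -, rfl⟩
    exact ⟨1, G.one_mem, by simp⟩

/-- Conjugation commutes with Zariski closure: `g (cl A) g⁻¹ ⊆ cl (g A g⁻¹)` (and hence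
equality, by symmetry), since `Int g` is a homeomorphism. [folklore] -/
theorem map_conj_zariskiClosure_le (A : Subgroup (GL n k)) (g : GL n k) :
    (zariskiClosure A).map (MulAut.conj g : GL n k →* GL n k) ≤
      zariskiClosure (A.map (MulAut.conj g : GL n k →* GL n k)) := by
  rintro _ ⟨x, hx, rfl⟩
  have hcont : Continuous fun y : GL n k => g * y * g⁻¹ :=
    ((isPolyMapGL_const g).mul isPolyMapGL_id).mul (isPolyMapGL_const g⁻¹) |>.continuous
  have hmaps : Set.MapsTo (fun y : GL n k => g * y * g⁻¹) (A : Set (GL n k))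
      ((zariskiClosure (A.map (MulAut.conj g : GL n k →* GL n k)) : Subgroup (GL n k)) :
        Set (GL n k)) := by
    intro y hy
    exact le_zariskiClosure _ ⟨y, hy, rfl⟩
  exact image_closure_subset_of_isClosed hcont isClosed_closure hmaps hx

/-- If `g` normalises `A` then it normalises the Zariski closure of `A`. [folklore] -/
theorem map_conj_zariskiClosure_eq {A : Subgroup (GL n k)} {g : GL n k}
    (hg : A.map (MulAut.conj g : GL n k →* GL n k) = A) :
    (zariskiClosure A).map (MulAut.conj g : GL n k →* GL n k) = zariskiClosure A := by
  refine le_antisymm (by simpa only [hg] using map_conj_zariskiClosure_le A g) ?_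
  -- apply the inclusion to `g⁻¹` and conjugate back
  have hg' : A.map (MulAut.conj g⁻¹ : GL n k →* GL n k) = A := by
    have h := congrArg (Subgroup.map (MulAut.conj g⁻¹ : GL n k →* GL n k)) hg
    rw [Subgroup.map_map] at h
    rw [← h]
    ext x
    simp [Subgroup.mem_map, mul_assoc]
  have h := map_conj_zariskiClosure_le A g⁻¹
  rw [hg'] at h
  have h' := Subgroup.map_mono (f := (MulAut.conj g : GL n k →* GL n k)) h
  rw [Subgroup.map_map] at h'
  refine le_trans (le_of_eq ?_) h'
  ext x
  simp [Subgroup.mem_map, mul_assoc]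

end Generation

end Literature.NumberTheory.Automorphic
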